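import Summits.QuantumFields.BalabanUV.Beta.GAN24.OffDiagSandwichFlat
import Summits.QuantumFields.BalabanUV.Beta.GAN24.TaylorMassVHPush

/-!
# `BalabanUV.Beta.GAN24.TaylorRowVSupport` — binder row G-an2-4 / (CONV-C), S-slot, road «S3-Taylor» (gan24-p1 `SKELETON-S3.md` v1.2 §16 /
# RULINGS-7; typer `LEAVES.md` v3.1 PART III row **S3-V**, holder `b2b-balaban-gan24-formalise-leaf-14-g18`, INTENT «ROW-V*» journal l.4689):
# ROW V, part 1 — THE (multiplier, field)-BLOCK SUPPORT OF THE PUSHED BORDER INCREMENT, THE RADII ∕ COUNT × MASS ARITHMETIC, THE POWER COUNT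

NOT IN PRINT; OUR BOOKKEEPING.  HONEST FRAMING (cell contract, verbatim): «discharging `BetaPertH` makes Bałaban's UV stability UNCONDITIONAL —
a real constructive-QFT result; it is NOT the continuum limit and NOT the Clay problem.»  HONEST DEPENDENCY (verbatim): «continuum YM on T⁴ ⇐
BetaPertH ∧ nine spine estimates (0/9 proved); BetaPertH ⇐ (D1) ∧ (D4) ∧ CAP+tail; G-an2-4 gates asym, D1 and NE2/3/4.»  [folklore] finite
combinatorics over VH1 (`GAN24/TaylorMassVH` ∕ `TaylorMassVHPush`, leaf-11) and an2's `pushSum` ∕ `borderInc` BY NAME, plus real arithmetic; cites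
nothing, mints no `def`, no `def … : Prop`, instantiates no wall binder.  Part 2 = `GAN24/TaylorRowV` (the entry estimate and `hV` at `d = 3`).
Discharges NOTHING of row V by itself; NOT BetaPertH, NOT continuum, NOT Clay.

## Contents ([folklore]; `d` generic, `Lc ≥ 1`; `M = Lc^{m+1}` the base level, `L = Lc^{k+1}` the number of pushed levels' blocking, `N = Lc^{m+k+3}`;
## `R_V = 2(d+1)(Lc+1) + 2d + 3` VH1's radius factor)
* `pushSum_borderInc_inr_inl_ne_zero` — the (multiplier, field)-block twin of VH1's `pushSum_borderInc_inl_inr_ne_zero`: a nonzero entry of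
  `pushSum (M·Lc) L (borderInc d Lc M κ u)` has its multiplier leg (first site) within `R_V·M + 2(d+1)·L·(M·Lc)` of `u` and its field leg within `R_V·M`.
* `radii_div_le` — `(R·M + (R·M + 2(d+1)·L·(M·Lc)))/N ≤ 2R + 2(d+1)`; `count_mul_mass_le` — `(2RM+1)^{d+1} · (L·(2R+1)^{d+1}·(M·3ℓ²/M^{d+1})) ≤
  ((2R+1)^{d+1})²·3ℓ²·L·M` (count of field sites in range × VH1's row mass = `O(L·M)`); **`prefactor_eq`** — THE POWER COUNT OF ROW V:
  `N^{−2}·Lc^{m+1}·(L·M) = Lc^{−2}·(Lc⁻¹)^{k+1}` (the (V-H) template's residual `N^{−2}·M` against the `O(L·M)` of count × mass is geometric in the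
  number of pushes, ratio `θ = Lc⁻¹` — gan24-p1's §12.5∕§16 count, NO cancellation); `abs_tsum_add_le_of_sum_abs_le` (two channels under one `Σ'`).
-/

noncomputable section

open Finset
open scoped BigOperators
open Literature.MathematicalPhysics.QuantumFieldTheory
open Literature.MathematicalPhysics.QuantumFieldTheory.Balaban1983to89
open Literature.MathematicalPhysics.QuantumFieldTheory.Balaban1983to89.Beta
open Literature.Probability.LatticeModels (Torus.proj)
open LatticeForm (quo)
open B12Sec2to5 (l1 l1_nonneg)
open ExpKernelCalculus (MKer l1_natSmul l1_sub_triangle l1_sub_symm)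
open OneStepResolventKernel (Fib eq_zsmul_quo_of_proj quo_zsmul proj_zsmul)
open OneStepKernelFamily (LegIdx legPt)
open BalabanCompositeJets (pushSum borderInc)
open Summit.QuantumFields.BalabanUV.Beta.GAN24.PushSumNest (pushSum_inr_of_proj_ne)
open Summit.QuantumFields.BalabanUV.Beta.GAN24.TaylorMassVH (borderInc_ne_zero)
open Summit.QuantumFields.BalabanUV.Beta.GAN24.TaylorMassVHPush (pushSum_inr_inl_coarse_sum)
open Summit.QuantumFields.BalabanUV.Beta.GAN24.OffDiagSandwichFlat (abs_tsum_le_of_sum_abs_le)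

namespace Summit.QuantumFields.BalabanUV.Beta.GAN24.TaylorRowVSupport

variable {d : ℕ} {Lc : ℕ} [NeZero Lc]

/-! ## §1 The support of the pushed border increment in the (multiplier, field) block; radii and prefactor arithmetic -/

/-- [folklore] **SUPPORT OF THE PUSHED INCREMENT, (multiplier, field) block** (the twin of VH1's
`TaylorMassVHPush.pushSum_borderInc_inl_inr_ne_zero`): a nonzero entry has its multiplier leg (first site, a point of the new coarse lattice)
within `R_V·M + 2(d+1)·L·(M·Lc)` of the fine bond `u` and its field leg (second site) within `R_V·M`. -/
theorem pushSum_borderInc_inr_inl_ne_zero (M L : ℕ) [NeZero M] [NeZero L] (hL : 1 ≤ Lc) {κ : Fin (d + 1)}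
    {u x y : Fin (d + 1) → ℤ} {μ α : Fin (d + 1)}
    (h : pushSum (M * Lc) L (borderInc d Lc M κ u) x y (Sum.inr μ) (Sum.inl α) ≠ 0) :
    l1 (x - u) ≤ ((2 * (d + 1) * (Lc + 1) + (2 * d + 3)) * M : ℕ) + 2 * ((d : ℝ) + 1) * L * (M * Lc : ℕ) ∧
      l1 (y - u) ≤ ((2 * (d + 1) * (Lc + 1) + (2 * d + 3)) * M : ℕ) := by
  have hproj : Torus.proj (M * Lc * L) x = 0 := by
    by_contra hne; exact h (pushSum_inr_of_proj_ne (M * Lc) L hne _ y μ _)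
  have ex := eq_zsmul_quo_of_proj (N := M * Lc * L) hproj
  rw [ex, pushSum_inr_inl_coarse_sum] at h
  obtain ⟨i', hi', hne⟩ := Finset.exists_ne_zero_of_sum_ne_zero h
  obtain ⟨hx, hy⟩ := borderInc_ne_zero M hL hne
  refine ⟨?_, hy⟩
  set W' := quo (M * Lc * L) x with hW'
  have hoff : l1 (legPt L (Sum.inl μ : Fib d) W' i' - (L : ℤ) • W') ≤ 2 * (d + 1) * L :=
    OneStepKernelFamily.l1_legPt_sub_le L (Sum.inl μ : Fib d) W' hi'
  have e1 : (((M * Lc * L : ℕ) : ℤ)) • W' = ((M * Lc : ℕ) : ℤ) • ((L : ℤ) • W') := by rw [smul_smul]; push_cast; ring_nf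
  have hdist : l1 ((((M * Lc * L : ℕ) : ℤ)) • W' - ((M * Lc : ℕ) : ℤ) • legPt L (Sum.inl μ : Fib d) W' i') ≤
      2 * ((d : ℝ) + 1) * L * (M * Lc : ℕ) := by
    rw [e1, ← smul_sub, l1_natSmul, l1_sub_symm]
    have hMLc : (0 : ℝ) ≤ (M * Lc : ℕ) := Nat.cast_nonneg _
    calc ((M * Lc : ℕ) : ℝ) * l1 (legPt L (Sum.inl μ : Fib d) W' i' - (L : ℤ) • W') ≤ ((M * Lc : ℕ) : ℝ) * (2 * (d + 1) * L) :=
          mul_le_mul_of_nonneg_left hoff hMLc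
      _ = 2 * ((d : ℝ) + 1) * L * (M * Lc : ℕ) := by ring
  rw [← ex] at hdist
  have tri := l1_sub_triangle x (((M * Lc : ℕ) : ℤ) • legPt L (Sum.inl μ : Fib d) W' i') u
  linarith

omit [NeZero Lc] in
/-- [folklore] Radii arithmetic: with `M = Lc^{m+1}`, `L = Lc^{k+1}`, `N = Lc^{m+k+3} = L·M·Lc` and `R` the VH1 radius factor,
`(R·M + (R·M + 2(d+1)·L·(M·Lc)))/N ≤ 2R + 2(d+1)`. -/
theorem radii_div_le (hL : 1 ≤ Lc) (R m k : ℕ) :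
    (((R * Lc ^ (m + 1) : ℕ) : ℝ) + ((R * Lc ^ (m + 1) + 2 * (d + 1) * Lc ^ (k + 1) * (Lc ^ (m + 1) * Lc) : ℕ) : ℝ)) /
        ((Lc ^ (m + k + 1 + 1 + 1) : ℕ) : ℝ) ≤ 2 * R + 2 * ((d : ℝ) + 1) := by
  have hL1 : (1 : ℝ) ≤ Lc := by exact_mod_cast hL
  have hLpos : (0 : ℝ) < Lc := by linarith
  have hN : ((Lc ^ (m + k + 1 + 1 + 1) : ℕ) : ℝ) = (Lc : ℝ) ^ (k + 1) * ((Lc : ℝ) ^ (m + 1) * Lc) := by push_cast; ring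
  have hNpos : (0 : ℝ) < (Lc : ℝ) ^ (k + 1) * ((Lc : ℝ) ^ (m + 1) * Lc) := by positivity
  rw [hN, div_le_iff₀ hNpos]
  push_cast
  have hM : (Lc : ℝ) ^ (m + 1) ≤ (Lc : ℝ) ^ (k + 1) * ((Lc : ℝ) ^ (m + 1) * Lc) := by
    have h1 : (1 : ℝ) ≤ (Lc : ℝ) ^ (k + 1) := one_le_pow₀ hL1
    have h2 : (Lc : ℝ) ^ (m + 1) ≤ (Lc : ℝ) ^ (m + 1) * Lc := le_mul_of_one_le_right (by positivity) hL1
    calc (Lc : ℝ) ^ (m + 1) = 1 * (Lc : ℝ) ^ (m + 1) := (one_mul _).symm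
      _ ≤ (Lc : ℝ) ^ (k + 1) * ((Lc : ℝ) ^ (m + 1) * Lc) := mul_le_mul h1 h2 (by positivity) (by positivity)
  have hR : (0 : ℝ) ≤ R := Nat.cast_nonneg R
  nlinarith [mul_le_mul_of_nonneg_left hM hR]

omit [NeZero Lc] in
/-- [folklore] Count × mass arithmetic: `(2·R·M + 1)^{d+1} · (L·(2R+1)^{d+1}·(M·3ℓ²/M^{d+1})) ≤ ((2R+1)^{d+1})²·3ℓ²·L·M` for `M ≥ 1`. -/
theorem count_mul_mass_le (hL : 1 ≤ Lc) (R : ℕ) (e : ℝ) (m k : ℕ) :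
    (2 * ((R * Lc ^ (m + 1) : ℕ) : ℝ) + 1) ^ (d + 1) *
        (((Lc ^ (k + 1) : ℕ) : ℝ) * ((((2 * R + 1) ^ (d + 1) : ℕ) : ℝ) *
          ((((Lc ^ (m + 1) : ℕ) : ℝ)) * (3 * e ^ 2 / (((Lc ^ (m + 1) : ℕ) : ℝ)) ^ (d + 1))))) ≤
      ((((2 * R + 1) ^ (d + 1) : ℕ) : ℝ)) ^ 2 * (3 * e ^ 2) * (Lc : ℝ) ^ (k + 1) * (Lc : ℝ) ^ (m + 1) := by
  have hL1 : (1 : ℝ) ≤ Lc := by exact_mod_cast hL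
  have hM1 : (1 : ℝ) ≤ (Lc : ℝ) ^ (m + 1) := one_le_pow₀ hL1
  have hMpos : (0 : ℝ) < (Lc : ℝ) ^ (m + 1) := by positivity
  push_cast
  have hcount : (2 * ((R : ℝ) * (Lc : ℝ) ^ (m + 1)) + 1) ^ (d + 1) ≤ ((2 * (R : ℝ) + 1) * (Lc : ℝ) ^ (m + 1)) ^ (d + 1) := by
    refine pow_le_pow_left₀ (by positivity) ?_ _
    nlinarith
  rw [mul_pow] at hcount
  have hmass : (Lc : ℝ) ^ (k + 1) * ((2 * (R : ℝ) + 1) ^ (d + 1) *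
      ((Lc : ℝ) ^ (m + 1) * (3 * e ^ 2 / ((Lc : ℝ) ^ (m + 1)) ^ (d + 1)))) =
      ((2 * (R : ℝ) + 1) ^ (d + 1) * (3 * e ^ 2) * (Lc : ℝ) ^ (k + 1) * (Lc : ℝ) ^ (m + 1)) /
        ((Lc : ℝ) ^ (m + 1)) ^ (d + 1) := by
    field_simp
  rw [hmass]
  have hD : (0 : ℝ) < ((Lc : ℝ) ^ (m + 1)) ^ (d + 1) := by positivity
  rw [mul_div_assoc', div_le_iff₀ hD]
  have hX : 0 ≤ (2 * (R : ℝ) + 1) ^ (d + 1) * (3 * e ^ 2) * (Lc : ℝ) ^ (k + 1) * (Lc : ℝ) ^ (m + 1) := by positivity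
  calc (2 * ((R : ℝ) * (Lc : ℝ) ^ (m + 1)) + 1) ^ (d + 1) *
        ((2 * (R : ℝ) + 1) ^ (d + 1) * (3 * e ^ 2) * (Lc : ℝ) ^ (k + 1) * (Lc : ℝ) ^ (m + 1))
      ≤ ((2 * (R : ℝ) + 1) ^ (d + 1) * ((Lc : ℝ) ^ (m + 1)) ^ (d + 1)) *
        ((2 * (R : ℝ) + 1) ^ (d + 1) * (3 * e ^ 2) * (Lc : ℝ) ^ (k + 1) * (Lc : ℝ) ^ (m + 1)) :=
        mul_le_mul_of_nonneg_right hcount hX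
    _ = ((2 * (R : ℝ) + 1) ^ (d + 1)) ^ 2 * (3 * e ^ 2) * (Lc : ℝ) ^ (k + 1) * (Lc : ℝ) ^ (m + 1) *
        ((Lc : ℝ) ^ (m + 1)) ^ (d + 1) := by ring

omit [NeZero Lc] in
/-- [folklore] **THE POWER COUNT OF ROW V** (`M = Lc^{m+1}`, `L = Lc^{k+1}`, `N = Lc^{m+k+3}`): the residual `N^{−2}·M` of the (V-H) template times the
`O(L·M)` of count × mass is `Lc^{−2}·(Lc⁻¹)^{k+1}` — geometric in the number of pushes. -/
theorem prefactor_eq (hL : 1 ≤ Lc) (m k : ℕ) :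
    ((Lc : ℝ) ^ (m + k + 1 + 1 + 1)) ^ (-(2 : ℤ)) * (Lc : ℝ) ^ (m + 1) * ((Lc : ℝ) ^ (k + 1) * (Lc : ℝ) ^ (m + 1)) =
      ((Lc : ℝ) ^ 2)⁻¹ * ((Lc : ℝ)⁻¹) ^ (k + 1) := by
  have hLpos : (0 : ℝ) < Lc := by exact_mod_cast Nat.lt_of_lt_of_le Nat.zero_lt_one hL
  have hL0 : (Lc : ℝ) ≠ 0 := hLpos.ne'
  rw [zpow_neg, zpow_ofNat, inv_pow]
  field_simp
  ring

/-- [folklore] Two channels under one outer sum: bounded partial sums of `|f|` and `|g|` bound `|Σ' (f + g)|`. -/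
theorem abs_tsum_add_le_of_sum_abs_le {S : Type*} {f g : S → ℝ} {a b : ℝ} (hf : ∀ Y : Finset S, ∑ y ∈ Y, |f y| ≤ a)
    (hg : ∀ Y : Finset S, ∑ y ∈ Y, |g y| ≤ b) : |∑' y, (f y + g y)| ≤ a + b := by
  refine abs_tsum_le_of_sum_abs_le fun Y => ?_
  calc ∑ y ∈ Y, |f y + g y| ≤ ∑ y ∈ Y, (|f y| + |g y|) := Finset.sum_le_sum fun y _ => abs_add_le _ _
    _ = ∑ y ∈ Y, |f y| + ∑ y ∈ Y, |g y| := Finset.sum_add_distrib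
    _ ≤ a + b := add_le_add (hf Y) (hg Y)

end Summit.QuantumFields.BalabanUV.Beta.GAN24.TaylorRowVSupport

end
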